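import Summits.QuantumFields.YangMills.Theorems.BalabanUVNodesN21TopLetteredReading13CoPHCore

/-!
# N21 (NE7c) · THE TOP-LETTERED SPINE READING — SANITY (A-guards): a band between a letter and itself vanishes; at ZERO WIDTH the reading's shell parts vanish identically
# (the zero-width instance IS the zero split — no hidden content); at depth budget `0` the selected letter is the run's own `ε`; the reading shares keys, class set, bad class,
# volume and `l₀` with dag-n20-d's `crOfRecord₁₃VAt` (`rfl`)

R134 seat `pub-ymgap-dag-n21-d` (g10), node N21 = NE7c, strategy s2; lane K3⁷ `SpineGivenEndpointR13SepCoPH` (stmt-QuantumFields-20544, `--supports … --as helper`;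
COUNT-NEUTRAL).  Imports R3 `…TopLetteredReading13CoPHCore` (hence R1∕R2, n20-d's `…SpineReadingOfRecord13CoPHV`).  Theorems only; 0 `def`, 0 `sorry`.

* §28 `topBandWeightAt_self_eq_zero` (NODE 00's generality: `∫ χ^{θ}(1 − χ^{θ})·topSlot = 0`, `χ ∈ {0,1}`) · `topBandAtLevel_self_eq_zero` · `cutGrid_width_zero` (`ρ = 0 ⇒ θ_i = ε`) ·
  ★ `topShellA₁₃_eq_zero_of_width_zero ∕ topShellB₁₃_eq_zero_of_width_zero` (at a comparison `K` with `ρ_K = 0` both runs' top-lettered shell parts are `0` at every key) ·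
  `selTopDepth₁₃_budget_zero` (`n = 0 ⇒ i⋆ = 0`) · `crTop₁₃VAt_T_eq ∕ _Bad_eq ∕ _vol_eq ∕ _l₀_eq ∕ _K₀_eq` against `crOfRecord₁₃VAt K₀ jcut sh` (`rfl`).

HONEST FRAMING.  Vacuity guards only; NO estimate; the reading is CONTENT only in the regime `0 < ρ_K < 1`, `(1 − ρ_K)^{n_K}` bounded below, `Σ 1∕(n_K+1) < ∞` (R2 header);
N21 NOT discharged; counts UNMOVED (typed 28∕28 · discharged 5∕27); nothing about ℝ⁴ ∕ OS ∕ mass gap ∕ Clay.  No `instance`, no `notation`, no `def`.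
-/

noncomputable section

open scoped BigOperators
open Finset MeasureTheory

namespace Summit.QuantumFields.YangMills.Theorems.N21ShellSplitOfRecord13CoPH

open Literature.MathematicalPhysics.QuantumFieldTheory.Balaban1983to89
open Literature.MathematicalPhysics.QuantumFieldTheory.Balaban1983to89.T4Continuum
open Literature.MathematicalPhysics.QuantumFieldTheory.Balaban1983to89.Node00
open YMDAG.UVSplit (ShellSplit₁₃CoPH crOfRecord₁₃VAt keyA₁₃ keyB₁₃ runA₁₃ runB₁₃ histA₁₃ histB₁₃ classSet₁₃ badClass₁₃)

/-! ## §28 Sanity -/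

section Generality

variable (F : T4Family) (N : ℕ) [NeZero N] (ϑ : Stage9Params F N) (D : FiniteEpsData F (SU N)) (g₀ : ℕ → ℝ) (os : List (ULoop F))
  (p : B12.RunParams) (g : ℕ → ℝ) (k : ℕ)

/-- **A BAND BETWEEN A LETTER AND ITSELF VANISHES** (`χ^{θ}(1 − χ^{θ}) = 0` pointwise, `{0,1}`-valued). [bookkeeping] -/
theorem topBandWeightAt_self_eq_zero (θ t : ℝ) (s' : SeqOfRecord F ϑ.ν ϑ.τ9.M g p.K (k + 1)) :
    topBandWeightAt F N ϑ D g₀ os p g k θ θ t s' = 0 := by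
  unfold topBandWeightAt
  refine (integral_congr_ae (ae_of_all _ fun V => ?_)).trans (integral_zero _ _)
  rcases chiSeqOfRecordAt_eq_zero_or_one F N ϑ p g (k + 1) θ s' V with h | h <;> simp [h]

/-- the same at every level. [bookkeeping] -/
theorem topBandAtLevel_self_eq_zero (θ t : ℝ) : ∀ (j : ℕ) (s : SeqOfRecord F ϑ.ν ϑ.τ9.M g p.K j), topBandAtLevel F N ϑ D g₀ os p g θ θ t j s = 0
  | 0, _ => rfl
  | k + 1, s' => topBandWeightAt_self_eq_zero F N ϑ D g₀ os p g k θ t s'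

variable {F N ϑ D g₀ os p} in
/-- **AT ZERO WIDTH THE GRID IS CONSTANT**: `cutGrid ν g k 0 i = ε_k`. [bookkeeping] -/
@[simp] theorem cutGrid_width_zero (i : ℕ) : cutGrid ϑ.ν g k 0 i = epsOfRecord ϑ.ν g k := by
  simp [cutGrid]

end Generality

section Reading

variable {F : T4Family} {N : ℕ} [NeZero N]

/-- ★ **AT ZERO WIDTH RUN A's TOP-LETTERED SHELL PART VANISHES IDENTICALLY** (every key, every depth letter): the zero-width instance of the reading is the zero split.
[bookkeeping] -/
theorem topShellA₁₃_eq_zero_of_width_zero (θ : Stage13HParams F N) (hP : θ.Provisos₁₃CoPH F N) (K₀ : ℕ) (g₀ : ℕ → ℝ) (os : List (ULoop F)) {ρ : ℕ → ℝ} (n : ℕ → ℕ)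
    {K : ℕ} (hρ : ρ K = 0) (t : ℝ) (x : Σ K, SiteSeqKey F (K₀ + K)) : topShellA₁₃ θ hP K₀ g₀ os ρ n K t x = 0 := by
  letI : ∀ Kc, DecidableEq (SiteSeqKey F Kc) := fun _ => Classical.decEq _
  unfold topShellA₁₃
  refine Finset.sum_eq_zero fun s _ => ?_
  rw [hρ, cutGrid_width_zero, cutGrid_width_zero]
  exact topBandAtLevel_self_eq_zero F N θ.toStage9Params (datumOfRecord₁₃CoPH F N θ hP) g₀ os (runA₁₃ F K₀ g₀ K) (histA₁₃ θ K₀ g₀ K) _ t _ s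

/-- ★ **… AND RUN B's.** [bookkeeping] -/
theorem topShellB₁₃_eq_zero_of_width_zero (θ : Stage13HParams F N) (hP : θ.Provisos₁₃CoPH F N) (K₀ : ℕ) (g₀ : ℕ → ℝ) (os : List (ULoop F)) {ρ : ℕ → ℝ} (n : ℕ → ℕ)
    {K : ℕ} (hρ : ρ K = 0) (t : ℝ) (x : Σ K, SiteSeqKey F (K₀ + K)) : topShellB₁₃ θ hP K₀ g₀ os ρ n K t x = 0 := by
  letI : ∀ Kc, DecidableEq (SiteSeqKey F Kc) := fun _ => Classical.decEq _
  unfold topShellB₁₃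
  refine Finset.sum_eq_zero fun s' _ => ?_
  rw [hρ, cutGrid_width_zero, cutGrid_width_zero]
  exact topBandAtLevel_self_eq_zero F N θ.toStage9Params (datumOfRecord₁₃CoPH F N θ hP) g₀ os (runB₁₃ F K₀ g₀ K) (histB₁₃ θ K₀ g₀ K) _ t _ s'

/-- **DEPTH BUDGET `0` SELECTS DEPTH `0`** — the selected top letter is then the run's own `ε` (`cutGrid … 0 = ε`). [bookkeeping] -/
theorem selTopDepth₁₃_budget_zero (θ : Stage13HParams F N) (hP : θ.Provisos₁₃CoPH F N) (K₀ : ℕ) (g₀ : ℕ → ℝ) (os : List (ULoop F)) (ρ : ℕ → ℝ) (K : ℕ) (t : ℝ) :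
    selTopDepth₁₃ θ hP K₀ g₀ os ρ 0 K t = 0 :=
  Nat.le_zero.1 (selTopDepth₁₃_le θ hP K₀ g₀ os ρ 0 K t)

/-! ### The reading shares every non-weight field with dag-n20-d's `crOfRecord₁₃VAt` (`rfl`) -/

section Dictionary

variable (K₀ : ℕ) (jcut : ℕ → ℕ) (sh : ShellSplit₁₃CoPH N K₀) (ρ : WidthLetter₁₃CoPH N) (n : DepthLetter₁₃CoPH N) (θ : Stage13HParams F N)
  (hP : θ.Provisos₁₃CoPH F N) (g₀ : ℕ → ℝ) (os : List (ULoop F))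

/-- same class set. [bookkeeping] -/
theorem crTop₁₃VAt_T_eq : (crTop₁₃VAt N K₀ jcut ρ n F θ hP g₀ os).T = (crOfRecord₁₃VAt K₀ jcut sh F θ hP g₀ os).T := rfl
/-- same bad class. [bookkeeping] -/
theorem crTop₁₃VAt_Bad_eq : (crTop₁₃VAt N K₀ jcut ρ n F θ hP g₀ os).Bad = (crOfRecord₁₃VAt K₀ jcut sh F θ hP g₀ os).Bad := rfl
/-- same volume letter. [bookkeeping] -/
theorem crTop₁₃VAt_vol_eq : (crTop₁₃VAt N K₀ jcut ρ n F θ hP g₀ os).vol = (crOfRecord₁₃VAt K₀ jcut sh F θ hP g₀ os).vol := rfl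
/-- same `l₀`. [bookkeeping] -/
theorem crTop₁₃VAt_l₀_eq : (crTop₁₃VAt N K₀ jcut ρ n F θ hP g₀ os).l₀ = (crOfRecord₁₃VAt K₀ jcut sh F θ hP g₀ os).l₀ := rfl
/-- same offset. [bookkeeping] -/
theorem crTop₁₃VAt_K₀_eq : (crTop₁₃VAt N K₀ jcut ρ n F θ hP g₀ os).K₀ = (crOfRecord₁₃VAt K₀ jcut sh F θ hP g₀ os).K₀ := rfl

end Dictionary

end Reading

end Summit.QuantumFields.YangMills.Theorems.N21ShellSplitOfRecord13CoPH

end
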